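import Summits.KontsevichZagierPeriods.KontsevichZagierPeriods.Theorems.HermiteRigidityIslandComplementCubeReflection

/-!
# `ReductionRigidity` (stmt-KontsevichZagierPeriods-3407), line `Sketch`, cycle 2 (the Landen join island):
# the weight-one cross-level reflection (`stub_joinReflection`)

Route `KontsevichZagierPeriods/HermiteRigidity`, crux `ReductionRigidity` (stmt-3407); registered
sub-goal stub J3 of the LANDEN JOIN ISLAND (the box sectors at the two levels `ν = q` and `ν = 1 − q`
of an integer `q ≥ 2`). For every rational `β`,

  `[□¹, β/((1 − q) − p)] − [□¹, (−β)/(q − p)] ∈ KZ.relations`,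

i.e. the level-`(1 − q)` weight-one normal form IS the level-`q` normal form with the opposite sign:
under the reflection `p ↦ 1 − p` of `[0,1]`, `β/((1 − q) − (1 − p)) = β/(p − q) = −β/(q − p)`.
One reflection move (`rel_reflect`, an affine involution of the cube, `|det| = 1`) between the two
regular rational functions `β/((1 − q) − X₀)` and `(−β)/(q − X₀)` on `□¹`, and two congruences
(rule 1b) to pass to arbitrary representations with the printed integrands.

References: M. Kontsevich, D. Zagier, *Periods* (2001), §1.2 rules (1)–(2) [cite: KontsevichZagier2001, §1.2].
No definitions are introduced.
-/

noncomputable section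

open MeasureTheory Set MvPolynomial

namespace Summit.KontsevichZagierPeriods.HermiteRigidity.ReductionRigidity

open Literature.NumberTheory.Transcendental
open Literature.NumberTheory.Transcendental.KZ

/-- The two weight-one normal forms `β/((1 − q) − p)` (level `1 − q`) and `−β/(q − p)` (level `q`)
are regular rational functions on `□¹` (`q ≥ 2`: the denominators are `≤ −1`, resp. `≥ 1`, on
`[0,1]`). [cite: KontsevichZagier2001, §1.1] -/
theorem exists_joinReflection_rfun {q : ℕ} (hq : 2 ≤ q) (β : ℚ) : ∃ S T : RFun 1,
    (∀ x ∈ cube 1, S.fn x = (β : ℝ) / ((1 - (q : ℝ)) - x 0)) ∧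
    (∀ x ∈ cube 1, T.fn x = -(β : ℝ) / ((q : ℝ) - x 0)) := by
  have h2 : (2:ℝ) ≤ (q:ℝ) := by exact_mod_cast hq
  have hS : ∀ x ∈ cube 1, aeval x (C (1 - (q:ℚ)) - X 0 : MvPolynomial (Fin 1) ℚ) ≠ 0 := by
    intro x hx
    have h0 := (hx 0).1
    simp only [map_sub, aeval_C, aeval_X, eq_ratCast, Rat.cast_one, Rat.cast_natCast]
    linarith
  have hT : ∀ x ∈ cube 1, aeval x (C (q:ℚ) - X 0 : MvPolynomial (Fin 1) ℚ) ≠ 0 := by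
    intro x hx
    have h1 := (hx 0).2
    simp only [map_sub, aeval_C, aeval_X, eq_ratCast, Rat.cast_natCast]
    linarith
  exact ⟨⟨C β, _, hS⟩, ⟨C (-β), _, hT⟩, fun x _ => by simp [RFun.fn_apply],
    fun x _ => by simp [RFun.fn_apply, neg_div]⟩

/-- **Stub `stub_joinReflection`** (sub-goal J3 of crux `ReductionRigidity`, stmt-3407, line `Sketch`,
cycle 2: the Landen join island): **the weight-one cross-level reflection.** For every integer `q ≥ 2`,
every rational `β` and any representations `r, s` on `[0,1]` with the printed integrands on it,
`[□¹, β/((1 − q) − p)] − [□¹, (−β)/(q − p)] ∈ KZ.relations`: the reflection `p ↦ 1 − p`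
(`rel_reflect`, rule 2 with `|det| = 1`) carries `(−β)/(q − p)` to `β/((1 − q) − p)`, and two
congruences (rule 1b) pass to `r` and `s`. [cite: KontsevichZagier2001, §1.2 rules (1)–(2)] -/
theorem stub_joinReflection : ∀ (q : ℕ), 2 ≤ q → ∀ (β : ℚ) (r s : IntegralRep 1),
    r.domain = cube 1 → EqOn r.integrand (fun p => (β : ℝ) / ((1 - (q : ℝ)) - p 0)) (cube 1) →
    s.domain = cube 1 → EqOn s.integrand (fun p => ((-β : ℚ) : ℝ) / ((q : ℝ) - p 0)) (cube 1) →
    KZ.of r - KZ.of s ∈ KZ.relations := by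
  intro q hq β r s hr hri hs hsi
  have h2 : (2:ℝ) ≤ (q:ℝ) := by exact_mod_cast hq
  obtain ⟨S, T, hS, hT⟩ := exists_joinReflection_rfun hq β
  -- the reflection `p ↦ 1 − p` carries `T` to `S`
  have hST : KZ.of S.rep - KZ.of T.rep ∈ KZ.relations := by
    refine rel_reflect 0 T S fun x hx => ?_
    have h0 := (hx 0).1
    have h1 := (hx 0).2
    have hx' : Function.update x 0 (1 - x 0) ∈ cube 1 :=
      KZ.update_mem_cube hx 0 (by linarith) (by linarith)
    have d1 : (1 - (q:ℝ)) - x 0 ≠ 0 := by linarith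
    have d2 : (q:ℝ) - (1 - x 0) ≠ 0 := by linarith
    rw [hS x hx, hT _ hx', Function.update_self, div_eq_div_iff d1 d2]
    ring
  -- congruences with the given representations
  have hrS : KZ.of r - KZ.of S.rep ∈ KZ.relations :=
    KZ.of_sub_of_mem_relations_of_eqOn (by rw [RFun.rep_domain, hr]) fun x hx => by
      rw [hr] at hx
      rw [RFun.rep_integrand, hri hx, hS x hx]
  have hTs : KZ.of T.rep - KZ.of s ∈ KZ.relations :=
    KZ.of_sub_of_mem_relations_of_eqOn (by rw [RFun.rep_domain, hs]) fun x (hx : x ∈ cube 1) => by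
      rw [RFun.rep_integrand, hsi hx, hT x hx]
      push_cast
      ring
  have e : KZ.of r - KZ.of s =
      (KZ.of r - KZ.of S.rep) + (KZ.of S.rep - KZ.of T.rep) + (KZ.of T.rep - KZ.of s) := by abel
  rw [e]
  exact KZ.relations.add_mem (KZ.relations.add_mem hrS hST) hTs

end Summit.KontsevichZagierPeriods.HermiteRigidity.ReductionRigidity

end
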